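import Summits.ValiantsHypothesis.ValiantsHypothesis.Theorems.BarrierLeverNaturalProofsSeparateVNPSignSliceEquation

/-!
# Route BarrierLever — item `NaturalProofsSeparateVNP` (stmt-ValiantsHypothesis-18972):
# the formalised CKRST equation is NEVER an absolute natural proof (kernel certificate)

The val-lit cell formalised Chatterjee–Kumar–Ramya–Saptharishi–Tengse's equation for the
`{0,1,-1}`-coefficient slice of `VP` in the tree frame
(`…NaturalProofsSeparateVNP.SignSlice.equation n a K R = Λ · ∏_{r=2}^{K} Q_{R,r}(∑_m z_m (a^m mod r))`,
files `BarrierLeverNaturalProofsSeparateVNPSignSlice*.lean`; it is a RELATIVE natural proof against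
`SmallCircuits ℂ n b ∩ signCoeffSlice ℂ n`, `SignSlice.signSlice_naturalProofRel`). Item 18972 needs
ABSOLUTE level-one natural proofs — vanishing on ALL of `SmallCircuits ℂ n b`. This file is the
kernel certificate that the CKRST equation, for every choice of its parameters `a, K, R`, is NOT one:
it does not vanish at the coefficient vector of the constant polynomial `1/2`, which lies in
`SmallCircuits ℂ n b` for every `n, b` (size `0`, degree `0`):

* `eval_equation_coeffVector_C_half_ne_zero` — `equation n a K R` at `coeff(C (1/2))` equals
  `(1/2)² · ∏_r ∏_{j ∈ roots R r} (1/2 - j) ≠ 0` (`Λ(coeff(C c)) = c²`; each linear form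
  `∑_m (a^m mod r) z_m` evaluates to `c`, since `a^0 mod r = 1`; no integer `j` equals `1/2`);
* `equation_not_isNaturalProof` — hence `¬ IsNaturalProof (degLEMonomials n) (SmallCircuits ℂ n b) 𝒟
  (SignSlice.equation n a K R)` for every `b` and every distinguisher class `𝒟`.

So the printed CKRST route cannot witness the item (as the informal record says: the equations are
slice-relative); what the item needs is CKRST's OPEN Question 1.4
(`naturalProofsSeparateVNP_of_question4_frame` in `…NaturalProofsSeparateVNPStatus`).

WHAT THIS IS NOT: nothing about other conceivable equations; item 18972, the crux and `VP ≠ VNP`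
are untouched.

References: [ChatterjeeKumarRamyaSaptharishiTengse2020] Thm. 1.1, §4 and Remark after Thm. 1.3;
[ForbesShpilkaVolk2018] Def. 1.
-/

-- layout Summits/ValiantsHypothesis/ValiantsHypothesis forces the duplicated namespace component
set_option linter.dupNamespace false

noncomputable section

namespace Summit.ValiantsHypothesis.ValiantsHypothesis.Theorems.BarrierLever.NaturalProofsSeparateVNP

open Literature.Barriers.ValiantsHypothesis Literature.Computability.AlgebraicComplexity MvPolynomial

/-- The zero exponent vector is a monomial of degree `≤ n`. [folklore] -/
theorem zero_mem_degLEMonomials (n : ℕ) : (0 : Fin n →₀ ℕ) ∈ degLEMonomials n := by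
  simp [degLEMonomials]

/-- `Λ = 1 - ∏_m (1 - z_m²)` at the coefficient vector of `C c` equals `c²`.
[cite: ChatterjeeKumarRamyaSaptharishiTengse2020, §4] -/
theorem eval_lam_coeffVector_C (n : ℕ) (c : ℂ) :
    eval (coeffVector (degLEMonomials n) (C c : MvPolynomial (Fin n) ℂ)) (SignSlice.lam n) =
      c ^ 2 := by
  set m₀ : degLEMonomials n := ⟨0, zero_mem_degLEMonomials n⟩ with hm₀
  simp only [SignSlice.lam, map_add, map_mul, map_prod, eval_C, eval_X]
  rw [Fintype.prod_eq_single m₀ fun m hm => ?_]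
  · simp [m₀]
    ring
  · have hne : (0 : Fin n →₀ ℕ) ≠ (m : Fin n →₀ ℕ) := fun h => hm (Subtype.ext (by rw [hm₀, ← h]))
    simp [hne]

/-- The linear form `∑_m w_m z_m` at the coefficient vector of `C c` equals `w(0) · c`.
[cite: ChatterjeeKumarRamyaSaptharishiTengse2020, §4] -/
theorem eval_linForm_coeffVector_C (n : ℕ) (c : ℂ) (w : degLEMonomials n → ℕ) :
    eval (coeffVector (degLEMonomials n) (C c : MvPolynomial (Fin n) ℂ)) (SignSlice.linForm w) =
      (w ⟨0, zero_mem_degLEMonomials n⟩ : ℂ) * c := by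
  set m₀ : degLEMonomials n := ⟨0, zero_mem_degLEMonomials n⟩ with hm₀
  simp only [SignSlice.linForm, map_sum, map_mul, eval_C, eval_X]
  rw [Fintype.sum_eq_single m₀ fun m hm => ?_]
  · simp [m₀]
  · have hne : (0 : Fin n →₀ ℕ) ≠ (m : Fin n →₀ ℕ) := fun h => hm (Subtype.ext (by rw [hm₀, ← h]))
    simp [hne]

/-- The weight of the zero monomial is `a^0 mod r = 1` for `r ≥ 2`. [folklore] -/
theorem modW_zero (n : ℕ) (a : Fin n → ℕ) {r : ℕ} (hr : 2 ≤ r) :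
    SignSlice.modW a r ⟨0, zero_mem_degLEMonomials n⟩ = 1 := by
  simp only [SignSlice.modW, SignSlice.monoVal, Finsupp.coe_zero, Pi.zero_apply, pow_zero,
    Finset.prod_const_one]
  exact Nat.one_mod_eq_one.mpr (by omega)

/-- Each factor `Q_{R,r}` (`r ≥ 2`) is nonzero at the coefficient vector of `C (1/2)`: its roots
are integers, and `1/2` is not an integer. [cite: ChatterjeeKumarRamyaSaptharishiTengse2020, §4] -/
theorem eval_qFactor_coeffVector_C_half_ne_zero (n R : ℕ) {r : ℕ} (hr : 2 ≤ r) (a : Fin n → ℕ) :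
    eval (coeffVector (degLEMonomials n) (C (1 / 2 : ℂ) : MvPolynomial (Fin n) ℂ))
      (SignSlice.qFactor R r (SignSlice.modW a r)) ≠ 0 := by
  simp only [SignSlice.qFactor, map_prod, map_add, eval_C]
  refine Finset.prod_ne_zero_iff.mpr fun j _ => ?_
  rw [eval_linForm_coeffVector_C, modW_zero n a hr, Nat.cast_one, one_mul]
  intro h
  have h2 : (1 : ℂ) = 2 * (j : ℂ) := by linear_combination 2 * h
  have h3 : (1 : ℤ) = 2 * j := by exact_mod_cast h2
  omega

/-- **The CKRST equation is nonzero at `coeff(C (1/2))`** — for all parameters `a, K, R`.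
[cite: ChatterjeeKumarRamyaSaptharishiTengse2020, §4] -/
theorem eval_equation_coeffVector_C_half_ne_zero (n K R : ℕ) (a : Fin n → ℕ) :
    eval (coeffVector (degLEMonomials n) (C (1 / 2 : ℂ) : MvPolynomial (Fin n) ℂ))
      (SignSlice.equation n a K R) ≠ 0 := by
  rw [SignSlice.equation, map_mul, map_prod, eval_lam_coeffVector_C]
  refine mul_ne_zero (by norm_num) (Finset.prod_ne_zero_iff.mpr fun r hr => ?_)
  exact eval_qFactor_coeffVector_C_half_ne_zero n R (Finset.mem_Icc.mp hr).1 a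

/-- Constants are in every `SmallCircuits ℂ n b` (size `0`, degree `0`).
[cite: ForbesShpilkaVolk2018, Cor. 5] -/
theorem C_mem_smallCircuits (n b : ℕ) (c : ℂ) :
    (C c : MvPolynomial (Fin n) ℂ) ∈ SmallCircuits ℂ n b :=
  ⟨by simp, (complexity_C_holds c).trans_le (Nat.zero_le _)⟩

/-- **The formalised CKRST equation is never an ABSOLUTE natural proof against `SmallCircuits ℂ n b`**
(any `b`, any distinguisher class `𝒟`, any parameters): it fails to vanish at the small circuit
`C (1/2)`. It is a natural proof only RELATIVE to the sign slice
(`SignSlice.signSlice_naturalProofRel`), which is why CKRST 2020 Thm. 1.1 cannot witness item 18972.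
[cite: ChatterjeeKumarRamyaSaptharishiTengse2020, Thm. 1.1 and §4] [cite: ForbesShpilkaVolk2018, Def. 1] -/
theorem equation_not_isNaturalProof (n b K R : ℕ) (a : Fin n → ℕ)
    (𝒟 : Set (MvPolynomial (degLEMonomials n) ℂ)) :
    ¬ IsNaturalProof (degLEMonomials n) (SmallCircuits ℂ n b) 𝒟 (SignSlice.equation n a K R) :=
  fun h => eval_equation_coeffVector_C_half_ne_zero n K R a (h.2.2 _ (C_mem_smallCircuits n b _))

end Summit.ValiantsHypothesis.ValiantsHypothesis.Theorems.BarrierLever.NaturalProofsSeparateVNP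

end
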